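import Summits.HodgeConjecture.HodgeConjecture.Theorems.K2E3LocalUnitaryWittParabolicDefs   -- ★ D₁ part 2∕2: `wittBlockNat`, `wittBlock`, `wittBlockOn`, `wittParabolic` …
import HarnessLib

/-!
# K2 ∕ E3 «EllipticInputs», 13a road A — DEFS LEAF D₁ (supplement) `K2E3LocalUnitaryWittRefinement`: REFINEMENT of the block labellings
# `wittBlock S` along `S ⊆ S′` (the `hmono` hypothesis of K2E3-p10's generic NEST ∕ Levi-triple file)

Cell `hodgecm-mathlib` (Track B «K2-LIT»), item h413 = `stmt-HodgeConjecture-24833`, line `K2_E3_EllipticInputs`, socket U12-g ∕ 13a road A; author K2-defs1 (g2)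
on K2E3-p10 (g2)'s cut (K2/STATUS 2026-09-03T23:37:51Z, item (b)); count-neutral; `--supports … --as helper`; same namespace as ★ `K2E3LocalUnitaryWittDefs` ∕
★ `K2E3LocalUnitaryWittParabolicDefs`.  No `sorry`, no named fact, no `instance`, no `notation`.

CONTENT.  The standard parabolics `P_S` (`S : Finset (Fin r)` = simple roots in the Levi) are block-upper-triangular for the labelling `wittBlock S`, which
counts the BREAKS `α ∉ S` lying before a position in the order `e₁ < … < e_r < (middle block) < f_r < … < f₁` (`wittPos`).  Each simple root `α` owns two
break SITES (after `e_{α+1}`, and the mirrored one before `f_{α+1}`); `wittSite α x ∈ {0, 1, 2}` counts the sites of `α` before `x`, it is MONOTONE in the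
position (`wittSite_mono`), and `wittBlockNat S x = Σ_{α ∉ S} wittSite α x` (`wittBlockNat_eq_sum`).  Consequences for `S ⊆ S′` (fewer breaks, coarser blocks):
* `wittBlockNat_le_of_subset`: `wittBlockNat S′ x ≤ wittBlockNat S x` (antitone in `S`);
* **`wittBlockNat_mono_of_subset`**: `wittBlockNat S k ≤ wittBlockNat S l → wittBlockNat S′ k ≤ wittBlockNat S′ l` — the labelling for `S′` is a COARSENING of
  the labelling for `S` (if `pos k ≤ pos l` this is monotonicity; otherwise the hypothesis forces «no `S`-break between `l` and `k`», a fortiori no `S′`-break);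
  `wittBlockNat_eq_of_subset` (`=` ⇒ `=`), and the transported forms `wittBlock_mono_of_subset` (on `.val`, the label types `Fin (2L+1)` ∕ `Fin (2L′+1)`
  differ) and **`wittBlockOn_mono_of_subset : wittBlockOn e S k ≤ wittBlockOn e S l → wittBlockOn e S′ k ≤ wittBlockOn e S′ l`** — VERBATIM the hypothesis
  `hmono : ∀ k l, c k ≤ c l → c' k ≤ c' l` of K2E3-p10's generic refinement∕NEST theorems with `c = wittBlockOn e S`, `c' = wittBlockOn e S′`, from which
  `P_S ≤ P_{S′}`, `M_S ≤ M_{S′}`, `N_{S′} ≤ N_S`, the NEST `N_S = (N_S ∩ M_{S′}) · N_{S′}` and the Levi triples `leviTriple S S′` follow there.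

HONEST LABEL: HC_CM is proved only modulo the 7 printed citations (2 remaining named inputs: hLiu418 = stmt-HodgeConjecture-24832, h413 =
stmt-HodgeConjecture-24833) until rung 0 closes; this file is count-neutral.

## References
* [Borel1991] A. Borel, *Linear Algebraic Groups*, 2nd ed. (1991), §23 (standard parabolics `P_I ⊆ P_{I′}` for `I ⊆ I′`; relative root systems).
* [BernsteinZelevinsky1977] I. N. Bernstein, A. V. Zelevinsky, Ann. Sci. ÉNS 10 (1977), §2.1 (standard parabolics of `GL_n` by ordered partitions; refinement).
-/

set_option autoImplicit false
-- the mandated namespace repeats `HodgeConjecture.HodgeConjecture`, as in every `Theorems/*.lean` of this sub-problem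
set_option linter.dupNamespace false

namespace Summit.HodgeConjecture.HodgeConjecture.Cruxes.H413.K2E3LocalUnitaryWitt

open Literature.NumberTheory.Automorphic

section Refinement

variable {r m : ℕ}

/-- The **position** of a Witt index in the flag order `e₁ < … < e_r < (middle block) < f_r < … < f₁`: `e_{i+1} ↦ i`, middle `↦ r`, `f`-slot `j ↦ r + 1 + j`
(all middle indices share the position `r`). [cite: Borel1991, §23] -/
def wittPos : WittIndex r m → ℕ
  | Sum.inl i => i.val
  | Sum.inr (Sum.inl _) => r
  | Sum.inr (Sum.inr j) => r + 1 + j.val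

/-- The **site count** of the simple root `α` before `x` (`∈ {0, 1, 2}`): the `e`-site of `α` (after `e_{α+1}`) lies before `e_{i+1}` iff `α < i`, before the
middle block and every `f`-slot always; the mirrored `f`-site (before `f_{α+1}`, i.e. before the slot `rev α`) lies before the `f`-slot `j` iff `rev α ≤ j`.
[cite: Borel1991, §23] -/
def wittSite (α : Fin r) : WittIndex r m → ℕ
  | Sum.inl i => if α.val < i.val then 1 else 0
  | Sum.inr (Sum.inl _) => 1
  | Sum.inr (Sum.inr j) => 1 + if (Fin.rev α).val ≤ j.val then 1 else 0

/-- **`wittBlockNat S x = Σ_{α ∉ S} wittSite α x`**: the label counts the active break sites before `x`. [cite: Borel1991, §23] -/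
theorem wittBlockNat_eq_sum (S : Finset (Fin r)) (x : WittIndex r m) :
    wittBlockNat S x = ∑ α ∈ Finset.univ \ S, wittSite α x := by
  rcases x with i | u | j
  · simp only [wittBlockNat, wittSite, Finset.card_filter]
  · simp only [wittBlockNat, wittSite, Finset.sum_const, smul_eq_mul, mul_one]
  · simp only [wittBlockNat, wittSite, Finset.sum_add_distrib, Finset.card_filter, Finset.sum_const, smul_eq_mul, mul_one]

/-- **Each site count is monotone in the position.** [cite: Borel1991, §23] -/
theorem wittSite_mono (α : Fin r) {x y : WittIndex r m} (h : wittPos x ≤ wittPos y) : wittSite α x ≤ wittSite α y := by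
  rcases x with i | u | j <;> rcases y with i' | u' | j' <;> simp only [wittPos, wittSite] at h ⊢ <;> (try split_ifs) <;> omega

/-- The label is monotone in the position (for every `S`). [cite: Borel1991, §23] -/
theorem wittBlockNat_mono_pos (S : Finset (Fin r)) {x y : WittIndex r m} (h : wittPos x ≤ wittPos y) : wittBlockNat S x ≤ wittBlockNat S y := by
  rw [wittBlockNat_eq_sum, wittBlockNat_eq_sum]
  exact Finset.sum_le_sum fun α _ => wittSite_mono α h

variable {S S' : Finset (Fin r)}

/-- **Antitone in `S`**: `S ⊆ S′` (fewer breaks) ⇒ `wittBlockNat S′ x ≤ wittBlockNat S x`. [cite: Borel1991, §23] -/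
theorem wittBlockNat_le_of_subset (hS : S ⊆ S') (x : WittIndex r m) : wittBlockNat S' x ≤ wittBlockNat S x := by
  rw [wittBlockNat_eq_sum, wittBlockNat_eq_sum]
  exact Finset.sum_le_sum_of_subset (Finset.sdiff_subset_sdiff (Finset.Subset.refl _) hS)

/-- **COARSENING (`hmono`)**: for `S ⊆ S′`, `wittBlockNat S k ≤ wittBlockNat S l → wittBlockNat S′ k ≤ wittBlockNat S′ l`.  If `pos k ≤ pos l` this is
`wittBlockNat_mono_pos`; otherwise `pos l ≤ pos k` gives the reverse inequality termwise, so the hypothesis forces EQUALITY of every site count over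
`α ∉ S`, in particular over `α ∉ S′`. [cite: Borel1991, §23] [cite: BernsteinZelevinsky1977, §2.1] -/
theorem wittBlockNat_mono_of_subset (hS : S ⊆ S') {k l : WittIndex r m} (hkl : wittBlockNat S k ≤ wittBlockNat S l) :
    wittBlockNat S' k ≤ wittBlockNat S' l := by
  rcases le_total (wittPos k) (wittPos l) with hp | hp
  · exact wittBlockNat_mono_pos S' hp
  · have hB : Finset.univ \ S' ⊆ Finset.univ \ S := Finset.sdiff_subset_sdiff (Finset.Subset.refl _) hS
    rw [wittBlockNat_eq_sum, wittBlockNat_eq_sum] at hkl ⊢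
    have hge : ∀ α ∈ Finset.univ \ S, wittSite α l ≤ wittSite α k := fun α _ => wittSite_mono α hp
    have heq : ∀ α ∈ Finset.univ \ S, wittSite α l = wittSite α k :=
      (Finset.sum_eq_sum_iff_of_le hge).1 (le_antisymm (Finset.sum_le_sum hge) hkl)
    exact (Finset.sum_congr rfl fun α hα => (heq α (hB hα)).symm).le

/-- `=` ⇒ `=`: indices in the same `S`-block are in the same `S′`-block (`S ⊆ S′`). [cite: BernsteinZelevinsky1977, §2.1] -/
theorem wittBlockNat_eq_of_subset (hS : S ⊆ S') {k l : WittIndex r m} (hkl : wittBlockNat S k = wittBlockNat S l) :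
    wittBlockNat S' k = wittBlockNat S' l :=
  le_antisymm (wittBlockNat_mono_of_subset hS hkl.le) (wittBlockNat_mono_of_subset hS hkl.ge)

/-- The `Fin`-valued form (on `.val`; the label types `Fin (2L+1)` and `Fin (2L′+1)` differ). [cite: BernsteinZelevinsky1977, §2.1] -/
theorem wittBlock_mono_of_subset (hS : S ⊆ S') {k l : WittIndex r m} (hkl : (wittBlock S k).val ≤ (wittBlock S l).val) :
    (wittBlock S' k).val ≤ (wittBlock S' l).val :=
  wittBlockNat_mono_of_subset hS hkl

/-- **`hmono` on a carrier** (verbatim the hypothesis of K2E3-p10's generic refinement ∕ NEST theorems, with `c = wittBlockOn e S`, `c' = wittBlockOn e S′`):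
`wittBlockOn e S k ≤ wittBlockOn e S l → wittBlockOn e S′ k ≤ wittBlockOn e S′ l` for `S ⊆ S′`. [cite: BernsteinZelevinsky1977, §2.1] [cite: Borel1991, §23] -/
theorem wittBlockOn_mono_of_subset {n : Type*} (e : WittIndex r m ≃ n) (hS : S ⊆ S') (k l : n)
    (hkl : wittBlockOn e S k ≤ wittBlockOn e S l) : wittBlockOn e S' k ≤ wittBlockOn e S' l := by
  rw [Fin.le_iff_val_le_val] at hkl ⊢
  exact wittBlockNat_mono_of_subset hS hkl

/-- Same `S`-block on a carrier ⇒ same `S′`-block. [cite: BernsteinZelevinsky1977, §2.1] -/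
theorem wittBlockOn_eq_of_subset {n : Type*} (e : WittIndex r m ≃ n) (hS : S ⊆ S') (k l : n)
    (hkl : wittBlockOn e S k = wittBlockOn e S l) : wittBlockOn e S' k = wittBlockOn e S' l :=
  le_antisymm (wittBlockOn_mono_of_subset e hS k l hkl.le) (wittBlockOn_mono_of_subset e hS l k hkl.ge)

end Refinement

/-! ## Consequence for the parabolics: `S ⊆ S′ ⇒ P_S ≤ P_{S′}` -/

section ParabolicMono

variable {R : Type*} [CommRing R] (σ : R →+* R) {n : Type*} [Fintype n] [DecidableEq n] (J : Matrix n n R) {r m : ℕ}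
  (e : WittIndex r m ≃ n) {S S' : Finset (Fin r)}

/-- **`P_S ≤ P_{S′}` for `S ⊆ S′`**: block triangular for the fine labelling ⇒ block triangular for the coarse one (contrapositive of `hmono`).
[cite: Borel1991, §23] [cite: BernsteinZelevinsky1977, §2.1] -/
theorem wittParabolic_mono (hS : S ⊆ S') : wittParabolic σ J e S ≤ wittParabolic σ J e S' := by
  intro g hg i j hij
  exact hg (lt_of_not_ge fun h => not_le_of_gt hij (wittBlockOn_mono_of_subset e hS i j h))

end ParabolicMono

/-! ## ED. 2 (append-only): labels of the MAXIMAL parabolic `P_{univ.erase α}` (one break, `α`) — the J1-lite casework of K2E3-p10 -/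

section MaximalParabolic

variable {r m : ℕ} (α : Fin r)

/-- **For the maximal parabolic `S = univ.erase α` the label is the site count of `α`**: `wittBlockNat (univ.erase α) x = wittSite α x`
(`univ ∖ (univ.erase α) = {α}`). [cite: Borel1991, §23] -/
theorem wittBlockNat_univ_erase (x : WittIndex r m) : wittBlockNat (Finset.univ.erase α) x = wittSite α x := by
  rw [wittBlockNat_eq_sum, Finset.sdiff_erase_self (Finset.mem_univ α), Finset.sum_singleton]

/-- Maximal parabolic, `e`-side: label of `e_{i+1}` is `[α < i]` (`0` up to `e_{α+1}`, then `1`). [cite: Borel1991, §23] -/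
@[simp] theorem wittBlockNat_univ_erase_inl (i : Fin r) :
    wittBlockNat (m := m) (Finset.univ.erase α) (Sum.inl i) = if α.val < i.val then 1 else 0 :=
  wittBlockNat_univ_erase α (Sum.inl i)

/-- Maximal parabolic, middle block: label `1`. [cite: Borel1991, §23] -/
@[simp] theorem wittBlockNat_univ_erase_inr_inl (u : Fin m) : wittBlockNat (Finset.univ.erase α) (Sum.inr (Sum.inl u)) = 1 :=
  wittBlockNat_univ_erase α (Sum.inr (Sum.inl u))

/-- Maximal parabolic, `f`-side: label of the `f`-slot `j` is `1 + [rev α ≤ j]` (`1` up to the slot before `f_{α+1}`, then `2`). [cite: Borel1991, §23] -/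
@[simp] theorem wittBlockNat_univ_erase_inr_inr (j : Fin r) :
    wittBlockNat (m := m) (Finset.univ.erase α) (Sum.inr (Sum.inr j)) = 1 + if (Fin.rev α).val ≤ j.val then 1 else 0 :=
  wittBlockNat_univ_erase α (Sum.inr (Sum.inr j))

/-- The `f`-side condition in the mirrored form: `rev α ≤ j ↔ rev j ≤ α` (as naturals). [cite: Borel1991, §23] -/
theorem rev_le_iff_rev_le (j : Fin r) : (Fin.rev α).val ≤ j.val ↔ (Fin.rev j).val ≤ α.val := by
  rw [Fin.val_rev, Fin.val_rev]
  omega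

end MaximalParabolic

/-! ## ED. 3 (append-only): removing one simple root from the Levi — `wittBlockNat (S.erase β) = wittBlockNat S + wittSite β` (K2E3-p10 (g3), item (A) `hexh`) -/

section EraseOne

variable {r m : ℕ} {S : Finset (Fin r)} {β : Fin r}

/-- **Label identity for `S.erase β`, `β ∈ S`**: the breaks of `S.erase β` are those of `S` plus the two sites of `β`, so
`wittBlockNat (S.erase β) x = wittBlockNat S x + wittSite β x` — the labelling of `P_{S∖β}` refines that of `P_S` by exactly the maximal-parabolic labelling of `β`
(`wittBlockNat_univ_erase`); used for `N_{S∖β} ∩ M_S ≤ N_{univ∖β}`. [cite: Borel1991, §23] [cite: BernsteinZelevinsky1977, §2.1] -/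
theorem wittBlockNat_erase (hβ : β ∈ S) (x : WittIndex r m) : wittBlockNat (S.erase β) x = wittBlockNat S x + wittSite β x := by
  have hβ' : β ∉ Finset.univ \ S := fun h => (Finset.mem_sdiff.1 h).2 hβ
  rw [wittBlockNat_eq_sum, wittBlockNat_eq_sum, Finset.sdiff_erase (Finset.mem_univ β), Finset.sum_insert hβ', add_comm]

/-- The same with the maximal-parabolic label: `wittBlockNat (S.erase β) x = wittBlockNat S x + wittBlockNat (univ.erase β) x`. [cite: Borel1991, §23] -/
theorem wittBlockNat_erase_eq_add_univ_erase (hβ : β ∈ S) (x : WittIndex r m) :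
    wittBlockNat (S.erase β) x = wittBlockNat S x + wittBlockNat (Finset.univ.erase β) x := by
  rw [wittBlockNat_erase hβ, wittBlockNat_univ_erase]

/-- Consequently the `S.erase β`-labels of two indices AGREE iff both their `S`-labels and their `univ.erase β`-labels agree (all labels are monotone in the
position, so the two summands cannot compensate). [cite: Borel1991, §23] -/
theorem wittBlockNat_erase_eq_iff (hβ : β ∈ S) (x y : WittIndex r m) :
    wittBlockNat (S.erase β) x = wittBlockNat (S.erase β) y ↔
      wittBlockNat S x = wittBlockNat S y ∧ wittBlockNat (Finset.univ.erase β) x = wittBlockNat (Finset.univ.erase β) y := by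
  refine ⟨fun h => ?_, fun h => by rw [wittBlockNat_erase_eq_add_univ_erase hβ, wittBlockNat_erase_eq_add_univ_erase hβ, h.1, h.2]⟩
  rw [wittBlockNat_erase_eq_add_univ_erase hβ, wittBlockNat_erase_eq_add_univ_erase hβ] at h
  rcases le_total (wittPos x) (wittPos y) with hp | hp
  · have h1 := wittBlockNat_mono_pos S hp
    have h2 := wittBlockNat_mono_pos (Finset.univ.erase β) hp
    constructor <;> omega
  · have h1 := wittBlockNat_mono_pos S hp
    have h2 := wittBlockNat_mono_pos (Finset.univ.erase β) hp
    constructor <;> omega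

end EraseOne

end Summit.HodgeConjecture.HodgeConjecture.Cruxes.H413.K2E3LocalUnitaryWitt
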